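import Summits.HodgeConjecture.HodgeConjecture.Theorems.HeckePrymWeilWeilDescendingUpward
import Summits.HodgeConjecture.HodgeConjecture.Theorems.HeckePrymWeilProductDescentTransfer
import Literature.AlgebraicGeometry.HodgeTheory.AlgebraicClassesCupAbelianVariety
import Literature.AlgebraicGeometry.Motives.ComplexPointsOrientation
import HarnessLib

/-!
# Crux `WeilSixfoldsSqrtMinus7` (stmt-HodgeConjecture-1260), line `hyperbolic-eightfold-descent` — stub `stub_descent`

Schoen's descent `8 → 6` for ONE partner surface (C. Schoen, *Addendum to: Hodge classes on
self-products of a variety with an automorphism*, Compositio Math. 114 (1998), §10; E. Markman,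
arXiv:2509.23403 §11.5 Step 2), on the tree's real carriers and GIVEN the unconditional
Künneth-for-Hodge-types statement as a hypothesis.

Statement (registered stub S5 of the line's skeleton): let `(A, φ)` be a complex abelian sixfold and
`(B, φ_B)` a complex abelian surface with `φ² = -7`, `φ_B² = -7`, `B` carrying a DESCENT PAIR
`(b₊, b₋, η)` — eigenclasses `b₊ ∈ Eig((𝟙+φ_B)^*, (1+i√7)²)`, `b₋ ∈ Eig((𝟙+φ_B)^*, (1-i√7)²)` of
`H²(B(ℂ); ℂ)` with `b₊ + b₋` rational of type `(1,1)`, and an ALGEBRAIC `η ∈ N¹H²(B(ℂ); ℂ)` with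
`b₊ ⌣ η ≠ 0`, `b₋ ⌣ η ≠ 0` — and `ψ = φ × φ_B` on `A × B`. IF every rational `(4,4)`-class in
`Eig((𝟙+ψ)^*, (1+i√7)⁸) ⊔ Eig((𝟙+ψ)^*, (1-i√7)⁸)` is algebraic on `A × B`, THEN every rational
`(3,3)`-class `c = c₊ + c₋` in `Eig((𝟙+φ)^*, (1+i√7)⁶) ⊔ Eig((𝟙+φ)^*, (1-i√7)⁶)` is algebraic on `A`.

Proof: exactly the mechanism of the tree's `productDescent_of`
(`Theorems/HeckePrymWeilProductDescent`) at `p = 7`, `n = 3`, with two simplifications — the Hodge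
type `(4,4)` of `pr_A^*(c₊ + c₋) ⌣ pr_B^*(b₊ + b₋)` comes from the FIRST HYPOTHESIS (Künneth for
Hodge types, `a = 6`, `b = 2`, `k = 6`, `l = 2`), and the partner divisor class `η` is GIVEN (no
Lefschetz `(1,1)` / Hodge index). The upward half `weilEigencomponents_mem_algebraicClasses_of_rung`
(rational Weil projector) makes `pr_A^* c± ⌣ pr_B^* b±` algebraic on `A × B`; `pr_B^* η` is
algebraic (`map_snd_mem_supportedClasses`), so `(pr_A^* c± ⌣ pr_B^* b±) ⌣ pr_B^* η` is algebraic
(moving by translations, `AbelianVariety.cupProduct_mem_algebraicClasses_one`); the fibre integrals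
`pr_{A*} pr_B^*(b± ⌣ η)` are non-zero (`complexGysin_fst_map_snd_ne_zero`, along the tree's real
Gysin maps `complexGysin μ` for the complex orientations `Motives.ComplexPoints.isOrientableOver`),
and Schoen's transfer `mem_algebraicClasses_of_complexGysin_fst_cupProduct` returns `c±`, hence
`c`, algebraic on `A`.
-/

noncomputable section

-- single-problem summit (Problem = Summit): the mandated namespace repeats `HodgeConjecture`.
set_option linter.dupNamespace false

open CategoryTheory
open Literature.AlgebraicGeometry Literature.AlgebraicGeometry.Motives
  Literature.AlgebraicGeometry.HodgeTheory Literature.AlgebraicTopology.SingularHomology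

namespace Summit.HodgeConjecture.HodgeConjecture.Theorems.WeilSixfoldsSqrtMinus7.HyperbolicEightfoldDescent

/-- **Stub 5 — Schoen's descent `8 → 6` for ONE partner surface, GIVEN the (unconditional)
Künneth-for-Hodge-types statement.** Let `(A, φ)` be a complex abelian sixfold and `(B, φ_B)` a
complex abelian surface, `φ² = φ_B² = -7`, `B` carrying a descent pair `(b₊, b₋, η)`, and
`ψ = φ × φ_B` on `A × B`. IF every rational `(4,4)`-class in the Weil span
`Eig((𝟙+ψ)^*, (1+i√7)⁸) ⊔ Eig((𝟙+ψ)^*, (1-i√7)⁸)` of `A × B` is algebraic, THEN every rational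
`(3,3)`-class `c = c₊ + c₋` in the Weil span of `A` is algebraic (Schoen 1998 §10; Markman
arXiv:2509.23403 §11.5 Step 2): the tree's `productDescent_of` at `p = 7`, `n = 3`, with the Hodge
type of the exterior product supplied by the first hypothesis and the partner divisor class `η`
given. -/
theorem stub_descent :
    (∀ (A B : AbelianVariety ℂ) (a b : ℕ), A.dim = a → B.dim = b →
      ∀ (k l m : ℕ) (hklm : k + l = m) (p q p' q' : ℕ)
        (c : complexBetti A.X k) (w : complexBetti B.X l),
        IsOfHodgeType a A.X k p q c → IsOfHodgeType b B.X l p' q' w →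
        IsOfHodgeType (a + b) (A.prod B).X m (p + p') (q + q')
          (cupProduct hklm (complexBetti.map (AbelianVariety.fst A B).hom.hom.hom k c)
            (complexBetti.map (AbelianVariety.snd A B).hom.hom.hom l w))) →
    ∀ (A : AbelianVariety ℂ) (φ : A ⟶ A) (B : AbelianVariety ℂ) (φB : B ⟶ B),
      A.dim = 6 → B.dim = 2 → φ ≫ φ = -((7 : ℤ) • 𝟙 A) → φB ≫ φB = -((7 : ℤ) • 𝟙 B) →
      (∃ bp bm η : complexBetti B.X 2,
        bp ∈ Module.End.eigenspace (complexBetti.map (𝟙 B + φB).hom.hom.hom 2).hom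
              ((1 + Complex.I * (Real.sqrt (7 : ℝ) : ℂ)) ^ 2) ∧
        bm ∈ Module.End.eigenspace (complexBetti.map (𝟙 B + φB).hom.hom.hom 2).hom
              ((1 - Complex.I * (Real.sqrt (7 : ℝ) : ℂ)) ^ 2) ∧
        IsRationalClass (bp + bm) ∧ IsOfHodgeType 2 B.X 2 1 1 (bp + bm) ∧
        η ∈ algebraicClasses B.X 1 ∧
        cupProduct (show 2 + 2 = 4 from rfl) bp η ≠ 0 ∧
        cupProduct (show 2 + 2 = 4 from rfl) bm η ≠ 0) →
      (∀ u : complexBetti (A.prod B).X 8, IsRationalClass u → IsOfHodgeType 8 (A.prod B).X 8 4 4 u →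
        u ∈ Module.End.eigenspace (complexBetti.map (𝟙 (A.prod B) +
                AbelianVariety.prodLift (AbelianVariety.fst A B ≫ φ)
                  (AbelianVariety.snd A B ≫ φB)).hom.hom.hom 8).hom
              ((1 + Complex.I * (Real.sqrt (7 : ℝ) : ℂ)) ^ 8) ⊔
            Module.End.eigenspace (complexBetti.map (𝟙 (A.prod B) +
                AbelianVariety.prodLift (AbelianVariety.fst A B ≫ φ)
                  (AbelianVariety.snd A B ≫ φB)).hom.hom.hom 8).hom
              ((1 - Complex.I * (Real.sqrt (7 : ℝ) : ℂ)) ^ 8) →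
        u ∈ algebraicClasses (A.prod B).X 4) →
      ∀ c : complexBetti A.X 6, IsRationalClass c → IsOfHodgeType 6 A.X 6 3 3 c →
        c ∈ Module.End.eigenspace (complexBetti.map (𝟙 A + φ).hom.hom.hom 6).hom
              ((1 + Complex.I * (Real.sqrt (7 : ℝ) : ℂ)) ^ 6) ⊔
            Module.End.eigenspace (complexBetti.map (𝟙 A + φ).hom.hom.hom 6).hom
              ((1 - Complex.I * (Real.sqrt (7 : ℝ) : ℂ)) ^ 6) →
        c ∈ algebraicClasses A.X 3 := by
  intro hK A φ B φB hA hB _hφ _hφB hpair halgAB c hc hcH hcW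
  obtain ⟨bp, bm, η, hbp, hbm, hbr, hbH, hη, hpt, hmt⟩ := hpair
  -- smoothness witnesses and the orientation family
  have hA6 : Motives.IsSmoothProjective (2 * 3) A.X := isSmoothProjective_of_dim_eq hA
  have hB2 : Motives.IsSmoothProjective (2 * 1) B.X := isSmoothProjective_of_dim_eq hB
  have hAB : Motives.IsSmoothProjective (2 * (3 + 1)) (A.prod B).X :=
    isSmoothProjective_prod_two_mul hA6 hB2
  let μ : OrientationFamily := fun _ _ h ↦
    Classical.choice (Motives.ComplexPoints.isOrientableOver ℂ h)
  -- `c = c₊ + c₋` along the two eigenvalues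
  obtain ⟨cp, hcp, cm, hcm, rfl⟩ := Submodule.mem_sup.1 hcW
  rw [Module.End.mem_eigenspace_iff] at hcp hcm hbp hbm
  -- the compatible endomorphism `Φ = φ × φ_B`
  set Φ : A.prod B ⟶ A.prod B := Motives.AbelianVariety.prodLift
    (Motives.AbelianVariety.fst A B ≫ φ) (Motives.AbelianVariety.snd A B ≫ φB)
  have h₁ : Φ ≫ Motives.AbelianVariety.fst A B = Motives.AbelianVariety.fst A B ≫ φ :=
    Motives.AbelianVariety.prodLift_fst _ _
  have h₂ : Φ ≫ Motives.AbelianVariety.snd A B = Motives.AbelianVariety.snd A B ≫ φB :=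
    Motives.AbelianVariety.prodLift_snd _ _
  -- numerology at `p = 7`, `n = 3`
  have hp4 : 4 ≤ (7 : ℕ) := by norm_num
  have hn : 1 ≤ (3 : ℕ) := by norm_num
  have h : 2 * 3 + 2 * 1 = 2 * (3 + 1) := rfl
  -- Hodge type `(4,4)` of `P = pr_A^* c ⌣ pr_B^*(b₊ + b₋)` (first hypothesis)
  have hH : IsOfHodgeType (2 * (3 + 1)) (A.prod B).X (2 * (3 + 1)) (3 + 1) (3 + 1)
      (cupProduct h
        (complexBetti.map (Motives.AbelianVariety.fst A B).hom.hom.hom (2 * 3) (cp + cm))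
        (complexBetti.map (Motives.AbelianVariety.snd A B).hom.hom.hom (2 * 1) (bp + bm))) :=
    hK A B 6 2 hA hB (2 * 3) (2 * 1) (2 * (3 + 1)) h 3 3 1 1 (cp + cm) (bp + bm) hcH hbH
  -- the rung hypothesis, re-typed at `2 * (3 + 1)` and `((7 : ℕ) : ℝ)`
  have halgAB' : ∀ u : complexBetti (A.prod B).X (2 * (3 + 1)), IsRationalClass u →
      IsOfHodgeType (2 * (3 + 1)) (A.prod B).X (2 * (3 + 1)) (3 + 1) (3 + 1) u →
        u ∈ Module.End.eigenspace (complexBetti.map (𝟙 (A.prod B) + Φ).hom.hom.hom (2 * (3 + 1))).hom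
              ((1 + Complex.I * (Real.sqrt ((7 : ℕ) : ℝ) : ℂ)) ^ (2 * (3 + 1))) ⊔
            Module.End.eigenspace (complexBetti.map (𝟙 (A.prod B) + Φ).hom.hom.hom (2 * (3 + 1))).hom
              ((1 - Complex.I * (Real.sqrt ((7 : ℕ) : ℝ) : ℂ)) ^ (2 * (3 + 1))) →
          u ∈ algebraicClasses (A.prod B).X (3 + 1) :=
    fun u hu huH huW ↦ halgAB u hu huH huW
  have hcp' : complexBetti.map (𝟙 A + φ).hom.hom.hom (2 * 3) cp =
      (1 + Complex.I * (Real.sqrt ((7 : ℕ) : ℝ) : ℂ)) ^ (2 * 3) • cp := hcp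
  have hcm' : complexBetti.map (𝟙 A + φ).hom.hom.hom (2 * 3) cm =
      (1 - Complex.I * (Real.sqrt ((7 : ℕ) : ℝ) : ℂ)) ^ (2 * 3) • cm := hcm
  have hbp' : complexBetti.map (𝟙 B + φB).hom.hom.hom (2 * 1) bp =
      (1 + Complex.I * (Real.sqrt ((7 : ℕ) : ℝ) : ℂ)) ^ (2 * 1) • bp := hbp
  have hbm' : complexBetti.map (𝟙 B + φB).hom.hom.hom (2 * 1) bm =
      (1 - Complex.I * (Real.sqrt ((7 : ℕ) : ℝ) : ℂ)) ^ (2 * 1) • bm := hbm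
  -- upward half: `pr_A^* c± ⌣ pr_B^* b±` are algebraic on `A × B`
  obtain ⟨hP, hMm⟩ := weilEigencomponents_mem_algebraicClasses_of_rung h₁ h₂ hp4 hn h hAB halgAB'
    hcp' hcm' hbp' hbm' hc hbr hH
  -- `pr_B^* η` is algebraic on `A × B`, hence so are `(pr_A^* c± ⌣ pr_B^* b±) ⌣ pr_B^* η`
  have hη' : complexBetti.map (Motives.AbelianVariety.snd A B).hom.hom.hom (2 * 1) η ∈
      algebraicClasses (A.prod B).X 1 :=
    map_snd_mem_supportedClasses hA6 hB2 hη
  have halgp := AbelianVariety.cupProduct_mem_algebraicClasses_one (A.prod B) hP hη'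
  have halgm := AbelianVariety.cupProduct_mem_algebraicClasses_one (A.prod B) hMm hη'
  -- the fibre integrals `pr_{A*} pr_B^*(b± ⌣ η) ≠ 0`
  have hjj' : 2 * 1 + 2 * 1 = 2 * (2 * 1) := rfl
  have hpt' : cupProduct hjj' bp η ≠ 0 := hpt
  have hmt' : cupProduct hjj' bm η ≠ 0 := hmt
  have hnep := complexGysin_fst_map_snd_ne_zero μ hA6 hB2 hpt'
  have hnem := complexGysin_fst_map_snd_ne_zero μ hA6 hB2 hmt'
  -- Schoen's transfer, component by component
  refine Submodule.add_mem _ ?_ ?_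
  · exact mem_algebraicClasses_of_complexGysin_fst_cupProduct μ hA6 hB2 (l := 3) (j := 2 * 1)
      (j' := 2 * 1) (s := 2 * (3 + 1)) h hjj' hnep halgp
  · exact mem_algebraicClasses_of_complexGysin_fst_cupProduct μ hA6 hB2 (l := 3) (j := 2 * 1)
      (j' := 2 * 1) (s := 2 * (3 + 1)) h hjj' hnem halgm

end Summit.HodgeConjecture.HodgeConjecture.Theorems.WeilSixfoldsSqrtMinus7.HyperbolicEightfoldDescent

end
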